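import Summits.CriticalPhenomena.CardyFormulaZ2.Theses.CardySelfDualSegment
import Literature.Probability.Percolation.CornerPercolation

/-!
# Sketch — crux UniformMarginality (stmt-CriticalPhenomena-5472), idea `five-arm-domination`

First checkable statements of the line (crux-ideate; nothing here is proved):
* the corner Hessian `H_t(v) = P(11) − P(10) − P(01) + P(00)` of the crude crossing event under
  forcing the corner at `v`;
* `RussoHessianIdentity` : `∂_t P_t(R,δ) = −¼ Σ_v H_t(v)` (exact; unsigned Russo for `prodBernoulli`
  along `cornerParam`);
* `AbsoluteMarginality` (the transfer C⁺): the Hessian field is uniformly ℓ¹-bounded;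
* `absoluteMarginality_imp` : C⁺ + identity ⇒ the crux, by `|P_t − P_{t₀}| ≤ (C/4)|t − t₀|`.
-/

namespace Summit.CriticalPhenomena.CardyFormulaZ2.Cruxes.UniformMarginality.FiveArmDomination

open MeasureTheory
open Literature.Probability.Percolation Literature.Probability.LatticeModels
  Literature.Probability.RandomPlanarGeometry

/-- Force the corner at `v` into the state (east = `x`, north = `y`): the coin `(v,0)` is set to
`x` and the splitting bit `(v,1)` to `x ≠ y` (north open iff coin ≠ bit); all other coordinates
of `S` are kept. -/
def forceCorner (v : Site 2) (x y : Bool) (S : Set (Site 2 × Fin 2)) : Set (Site 2 × Fin 2) :=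
  {i | (i.1 ≠ v ∧ i ∈ S) ∨ (i = (v, 0) ∧ x = true) ∨ (i = (v, 1) ∧ x ≠ y)}

/-- Crude crossing probability of `R` at mesh `δ` by `M_t` with the corner at `v` forced to
`(x, y)`. -/
noncomputable def forcedCrossingProb (t : unitInterval) (R : ConformalRectangle) (δ : ℝ)
    (v : Site 2) (x y : Bool) : ℝ :=
  (prodBernoulli (cornerParam t)).real
    {S | cornerConfig (forceCorner v x y S) ∈
      embDomainCrossing squareLatticeEmbedding.z R.carrier δ (R.arc 0) (R.arc 2)}

/-- The corner Hessian `H_t(v) = P(11) − P(10) − P(01) + P(00) = P_t(Ser_v) − P_t(Par_v)`. -/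
noncomputable def cornerHessian (t : unitInterval) (R : ConformalRectangle) (δ : ℝ)
    (v : Site 2) : ℝ :=
  forcedCrossingProb t R δ v true true - forcedCrossingProb t R δ v true false
    - forcedCrossingProb t R δ v false true + forcedCrossingProb t R δ v false false

/-- FIRST LEMMA (exact identity). For fixed `R, δ` only finitely many corners carry a non-zero
Hessian, and `t ↦ P_t(R, δ)` is differentiable on `[0,1]` with derivative `−¼ Σ_v H_t(v)`
(unsigned Russo formula for the product measure `prodBernoulli (cornerParam t)`: the corner law
`(½−t/4 | t/4 ; t/4 | ½−t/4) = (1−t)·tied + t·free` is affine in `t`). -/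
def RussoHessianIdentity : Prop :=
  ∀ (R : ConformalRectangle) (δ : ℝ), 0 < δ → ∃ V : Finset (Site 2),
    (∀ v ∉ V, ∀ t : unitInterval, cornerHessian t R δ v = 0) ∧
    ∀ t₀ : unitInterval,
      HasDerivWithinAt (fun s : ℝ => cornerCrossingProb (Set.projIcc 0 1 zero_le_one s) R δ)
        (-(1 / 4 : ℝ) * ∑ v ∈ V, cornerHessian t₀ R δ v) (Set.Icc 0 1) (t₀ : ℝ)

/-- TRANSFER C⁺ — ABSOLUTE MARGINALITY: the corner-Hessian field of every conformal rectangle is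
uniformly `ℓ¹`-bounded in the corner, uniformly in `t ∈ [0,1]` and in the mesh. (Implied by the
card's pointwise five-arm domination + universal five-arm / half-plane three-arm counting;
implies the crux with Lipschitz modulus `C/4`.) -/
def AbsoluteMarginality : Prop :=
  ∀ R : ConformalRectangle, ∃ C : ℝ, ∀ (t : unitInterval) (δ : ℝ), 0 < δ →
    ∀ V : Finset (Site 2), ∑ v ∈ V, |cornerHessian t R δ v| ≤ C

/-- The glue of the line (provable now, elementary real analysis on `[0,1]`): the identity and
absolute marginality give the crux `UniformMarginality` (with `η = 4ε/C`). -/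
theorem absoluteMarginality_imp :
    RussoHessianIdentity → AbsoluteMarginality →
      Summit.CriticalPhenomena.CardyFormulaZ2.Theses.CardySelfDualSegment.UniformMarginality := by
  sorry

end Summit.CriticalPhenomena.CardyFormulaZ2.Cruxes.UniformMarginality.FiveArmDomination
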